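import Summits.ValiantsHypothesis.ValiantsHypothesis.Theses.DivisionGap

/-!
# Line `typed-parse-tree-weights` — crux `PerMultiplesHard` (stmt-ValiantsHypothesis-5068, route DivisionGap)

Checked skeleton (crux-plan, round 1).  Lever of the card: Jerrum–Snir's complete parse-tree weight
argument (JS82 §3) re-indexed by TORUS TYPES `τ = (row margins, column margins)` of exponent tables.
Two sharpenings found while planning (see `Lines/typed-parse-tree-weights.md`):

* the weight recursion is telescoped along ONE root-to-leaf path of the parse tree (the child of larger
  potential), which makes the bound DEGREE-BLIND (no factor `K+1` from repeated parse-tree nodes —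
  the multiplier `h` is uncharged, so its exponents are unbounded), and
* monomials are weighted by an arbitrary test measure `p ≥ 0`, so that the one engine `stub_pathWeightBound`
  hosts Jerrum–Snir (`p ≡ 1` on a face of the Birkhoff polytope: `stub_faceCertificate`), the typed
  pure-vertex count F3 (`p` uniform on thin monomials: `stub_thinCertificate`) and the card's typed LP.

Composition: `PerMultiplesHard_of` = normal form (`stub_multihomogeneousNormalForm`, top forms are free)
→ thin-rich multipliers by `stub_thinCertificate` → thin-poor multipliers by the OPEN CORE
`stub_hybridDescent` (free face descent to a rich sub-permanent, or to a path-certifiable pair) →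
`stub_faceCertificate` / the certificate → `stub_pathWeightBound`.

Lead-1 reshape (2026-08-16): S5 now asks for hardness TRANSFER at an explicit level `Y`
(`Y < L(target) → 2^X < L(per_n · h)`) instead of the exact `L(target) ≤ L(per_n · h)`, so that
degenerations with polynomial loss (JSS monomial stripping) are admissible exits; S1–S4 unchanged.

Types are written `(Finsupp.mapDomain Prod.fst m, Finsupp.mapDomain Prod.snd m)`; every stub is
stated over tree declarations only (no local definitions), so that its registered signature is
self-contained.
-/

noncomputable section

set_option linter.dupNamespace false

open scoped BigOperators

namespace Summit.ValiantsHypothesis.ValiantsHypothesis.Cruxes.PerMultiplesHard.TypedParseTreeWeights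

/-! ## S1 — the engine: measured, typed, path-telescoped Jerrum–Snir bound (TRUE; size L) -/

/-- **S1 `stub_pathWeightBound`** (engine; Jerrum–Snir 1982 Thm 3.3–3.5 with (i) degrees replaced by
torus types, (ii) the recursion telescoped along the root-to-leaf path of the parse tree that always
enters the child of larger potential `φ`, (iii) monomials weighted by a test measure `p ≥ 0`).
For a single-typed target `g` over `ℝ≥0` (all monomials of type `τg`): if `φ` vanishes on leaves and
`(φ(τ₁+τ₂) - max(φ τ₁, φ τ₂)) · Σ_{A×B×C} p(a+b+c) ≤ 1` for every admissible triple (types `τ₁, τ₂`,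
`A + B + C ⊆ supp g`), then `(Σ_{m ∈ supp g} p m) · φ(τg) ≤ 2 · L(g)` (`2` = PlainBridge factor,
`exists_isMonotoneComputation_prodCount_le`).  Degree-blind: gates on one path are distinct, and
`m ↦ (a, b, m - a - b)` is injective per gate, so no multiplicity factor arises.
[cite: JerrumSnir1982, Thm 3.3–3.5] -/
theorem stub_pathWeightBound :
    ∀ (n : ℕ) (g : MvPolynomial (Fin n × Fin n) NNReal) (τg : (Fin n →₀ ℕ) × (Fin n →₀ ℕ)),
      (∀ m ∈ g.support, (Finsupp.mapDomain Prod.fst m, Finsupp.mapDomain Prod.snd m) = τg) →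
      ∀ (p : ((Fin n × Fin n) →₀ ℕ) → ℝ), (∀ m, 0 ≤ p m) →
      ∀ (φ : (Fin n →₀ ℕ) × (Fin n →₀ ℕ) → ℝ), φ 0 ≤ 0 →
        (∀ e : Fin n × Fin n, φ (Finsupp.single e.1 1, Finsupp.single e.2 1) ≤ 0) →
        (∀ (A B C : Finset ((Fin n × Fin n) →₀ ℕ)) (τ₁ τ₂ : (Fin n →₀ ℕ) × (Fin n →₀ ℕ)),
          (∀ a ∈ A, (Finsupp.mapDomain Prod.fst a, Finsupp.mapDomain Prod.snd a) = τ₁) →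
          (∀ b ∈ B, (Finsupp.mapDomain Prod.fst b, Finsupp.mapDomain Prod.snd b) = τ₂) →
          (∀ a ∈ A, ∀ b ∈ B, ∀ c ∈ C, a + b + c ∈ g.support) →
          (φ (τ₁ + τ₂) - max (φ τ₁) (φ τ₂)) * (∑ a ∈ A, ∑ b ∈ B, ∑ c ∈ C, p (a + b + c)) ≤ 1) →
        (∑ m ∈ g.support, p m) * φ τg
          ≤ 2 * (Literature.Computability.AlgebraicComplexity.complexity g : ℝ) := by
  sorry

/-! ## S2 — normal form: WLOG the multiplier is multihomogeneous (TRUE; size S–M) -/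

/-- **S2 `stub_multihomogeneousNormalForm`** (top forms are free over `ℝ≥0`, and `per_n` is
homogeneous for the `2n` row/column weights): every nonzero `h` has a nonzero single-typed slice `h'`
(`supp h' ⊆ supp h`, all monomials with the same row and column margins) with
`L(per_n · h') ≤ L(per_n · h)` and `L(h') ≤ L(h)`.  In tree: `Theorems/PerMultiplesHard/Negative/TopForms.lean`
(`complexity_mul_multiTop_le`, `multiTop_ne_zero`, `isWeightedHomogeneous_multiTop`); the permanent-specific
half is `Cruxes/PerMultiplesHard/Disproof.lean` §(h) (`exists_multihomogeneous_multiple_le`,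
`support_multiTop_subset`). [cite: JerrumSnir1982, §2] -/
theorem stub_multihomogeneousNormalForm :
    ∀ (n : ℕ) (h : MvPolynomial (Fin n × Fin n) NNReal), h ≠ 0 →
      ∃ h' : MvPolynomial (Fin n × Fin n) NNReal, h' ≠ 0 ∧ h'.support ⊆ h.support ∧
        (∃ τ : (Fin n →₀ ℕ) × (Fin n →₀ ℕ),
          ∀ m ∈ h'.support, (Finsupp.mapDomain Prod.fst m, Finsupp.mapDomain Prod.snd m) = τ) ∧
        Literature.Computability.AlgebraicComplexity.complexity
            (Literature.Computability.AlgebraicComplexity.perPoly (Fin n) NNReal * h') ≤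
          Literature.Computability.AlgebraicComplexity.complexity
            (Literature.Computability.AlgebraicComplexity.perPoly (Fin n) NNReal * h) ∧
        Literature.Computability.AlgebraicComplexity.complexity h' ≤
          Literature.Computability.AlgebraicComplexity.complexity h := by
  sorry

/-! ## S3 — the thin certificate: typed pure-vertex counting inside the engine (TRUE; size M) -/

/-- **S3 `stub_thinCertificate`** (the sibling pool's typed pure-vertex count F3 / `ThinPatternBound`,
as a certificate for S1, hence degree-blind and with no `K+1` loss).  For single-typed `h` and `n ≥ 3`
the target `per_n · h` carries a path certificate of value `≥ #thin(h) · C(n, ⌊n/3⌋) / n!`, where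
`π` is THIN for `h` if some monomial of `h` is supported inside the graph `{(π j, j)}` of `π`
(then `P_π + m_π ∈ supp(per·h)` has pattern exactly `π`).  Certificate: `p` uniform on the thin
monomials, `φ = W · [column support > 2n/3]`, `W = C(n,⌊n/3⌋) · #thin / n!`; a gate whose operand
type has column support `k ∈ (n/3, 2n/3]` serves at most `k!(n-k)! ≤ n!/C(n,⌊n/3⌋)` thin monomials.
Consequence with S1: `L(per_n^N) ≥ C(n,⌊n/3⌋)/2` for every `N ≥ 1`. [cite: JerrumSnir1982, §4.3] -/
theorem stub_thinCertificate :
    ∀ (n : ℕ), 3 ≤ n → ∀ (h : MvPolynomial (Fin n × Fin n) NNReal) (τ : (Fin n →₀ ℕ) × (Fin n →₀ ℕ)),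
      (∀ m ∈ h.support, (Finsupp.mapDomain Prod.fst m, Finsupp.mapDomain Prod.snd m) = τ) →
      ∃ (τg : (Fin n →₀ ℕ) × (Fin n →₀ ℕ)) (p : ((Fin n × Fin n) →₀ ℕ) → ℝ)
        (φ : (Fin n →₀ ℕ) × (Fin n →₀ ℕ) → ℝ),
        (∀ m ∈ (Literature.Computability.AlgebraicComplexity.perPoly (Fin n) NNReal * h).support,
          (Finsupp.mapDomain Prod.fst m, Finsupp.mapDomain Prod.snd m) = τg) ∧
        (∀ m, 0 ≤ p m) ∧ φ 0 ≤ 0 ∧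
        (∀ e : Fin n × Fin n, φ (Finsupp.single e.1 1, Finsupp.single e.2 1) ≤ 0) ∧
        (∀ (A B C : Finset ((Fin n × Fin n) →₀ ℕ)) (τ₁ τ₂ : (Fin n →₀ ℕ) × (Fin n →₀ ℕ)),
          (∀ a ∈ A, (Finsupp.mapDomain Prod.fst a, Finsupp.mapDomain Prod.snd a) = τ₁) →
          (∀ b ∈ B, (Finsupp.mapDomain Prod.fst b, Finsupp.mapDomain Prod.snd b) = τ₂) →
          (∀ a ∈ A, ∀ b ∈ B, ∀ c ∈ C, a + b + c ∈
            (Literature.Computability.AlgebraicComplexity.perPoly (Fin n) NNReal * h).support) →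
          (φ (τ₁ + τ₂) - max (φ τ₁) (φ τ₂)) * (∑ a ∈ A, ∑ b ∈ B, ∑ c ∈ C, p (a + b + c)) ≤ 1) ∧
        ((((Finset.univ : Finset (Equiv.Perm (Fin n))).filter (fun π =>
            ∃ m ∈ h.support, ∀ e : Fin n × Fin n, m e ≠ 0 → π e.2 = e.1)).card : ℕ) : ℝ) *
            (n.choose (n / 3) : ℝ) ≤
          (n.factorial : ℝ) *
            ((∑ m ∈ (Literature.Computability.AlgebraicComplexity.perPoly (Fin n) NNReal * h).support,
                p m) * φ τg) := by
  sorry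

/-! ## S4 — the face certificate: Jerrum–Snir on a face of the Birkhoff polytope (TRUE; size M) -/

/-- **S4 `stub_faceCertificate`** (Jerrum–Snir's permanent weights are path-feasible up to `n² + 1`).
For every bipartite graph `G ⊆ [n]×[n]` the face permanent `per(G) = Σ_{π ⊆ G} x^{P_π}` carries a
path certificate of value `≥ |PM(G)| · n(2^{n-1}-1) / ((n²+1) · n!)`: `p ≡ 1` on `PM(G)`,
`φ(τ) = w_JS(|τ|)/(n²+1)` with the tree's `JerrumSnir.perWeight` (`n! · w_JS(n) = n(2^{n-1}-1)`,
`factorial_mul_perWeight`); the path constraint `φ(r) - φ(r-d) ≤ 1/δ(r,d)` follows from the tree's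
recurrence `perWeight_rec` and `(w(r) - w(r-d)) · δ(r,d) ≤ d² + 1`; the content bound for `PM(G) ⊆ B_n`
is the permanent's (`contentBound_perPoly`, `card_mul_card_mul_card_le` in `MonotoneGapPermanentLower.lean`). [cite: JerrumSnir1982, §4.3] -/
theorem stub_faceCertificate :
    ∀ (n : ℕ) (G : Finset (Fin n × Fin n)),
      ∃ (τg : (Fin n →₀ ℕ) × (Fin n →₀ ℕ)) (p : ((Fin n × Fin n) →₀ ℕ) → ℝ)
        (φ : (Fin n →₀ ℕ) × (Fin n →₀ ℕ) → ℝ),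
        (∀ m ∈ (∑ π ∈ (Finset.univ : Finset (Equiv.Perm (Fin n))).filter (fun π => ∀ i : Fin n, (π i, i) ∈ G),
            ∏ i : Fin n, (MvPolynomial.X (π i, i) : MvPolynomial (Fin n × Fin n) NNReal)).support,
          (Finsupp.mapDomain Prod.fst m, Finsupp.mapDomain Prod.snd m) = τg) ∧
        (∀ m, 0 ≤ p m) ∧ φ 0 ≤ 0 ∧
        (∀ e : Fin n × Fin n, φ (Finsupp.single e.1 1, Finsupp.single e.2 1) ≤ 0) ∧
        (∀ (A B C : Finset ((Fin n × Fin n) →₀ ℕ)) (τ₁ τ₂ : (Fin n →₀ ℕ) × (Fin n →₀ ℕ)),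
          (∀ a ∈ A, (Finsupp.mapDomain Prod.fst a, Finsupp.mapDomain Prod.snd a) = τ₁) →
          (∀ b ∈ B, (Finsupp.mapDomain Prod.fst b, Finsupp.mapDomain Prod.snd b) = τ₂) →
          (∀ a ∈ A, ∀ b ∈ B, ∀ c ∈ C, a + b + c ∈
            (∑ π ∈ (Finset.univ : Finset (Equiv.Perm (Fin n))).filter (fun π => ∀ i : Fin n, (π i, i) ∈ G),
              ∏ i : Fin n, (MvPolynomial.X (π i, i) : MvPolynomial (Fin n × Fin n) NNReal)).support) →
          (φ (τ₁ + τ₂) - max (φ τ₁) (φ τ₂)) * (∑ a ∈ A, ∑ b ∈ B, ∑ c ∈ C, p (a + b + c)) ≤ 1) ∧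
        ((((Finset.univ : Finset (Equiv.Perm (Fin n))).filter (fun π => ∀ i : Fin n, (π i, i) ∈ G)).card : ℕ) : ℝ) *
            ((n : ℝ) * ((2 : ℝ) ^ (n - 1) - 1)) ≤
          (((n : ℝ) ^ 2 + 1) * (n.factorial : ℝ)) *
            ((∑ m ∈ (∑ π ∈ (Finset.univ : Finset (Equiv.Perm (Fin n))).filter (fun π => ∀ i : Fin n, (π i, i) ∈ G),
                ∏ i : Fin n, (MvPolynomial.X (π i, i) : MvPolynomial (Fin n × Fin n) NNReal)).support, p m) *
              φ τg) := by
  sorry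

/-! ## S5 — the open core: hybrid descent (CONJECTURAL) -/

/-- **S5 `stub_hybridDescent`** (OPEN CORE of the line; conjectural; RESHAPED by lead-1: hardness
TRANSFER at an explicit level `Y` replaces the exact inequalities `L(·) ≤ L(per_n · h)` of round 1, so that
free degenerations WITH POLYNOMIAL LOSS — monomial stripping by Jukna–Seiwert–Sergeev contraction
(`JSS.stub_jssContraction`: `L(f) ≤ ((n+2)(L(x^u·f)+2))^κ`), or any future transfer lemma — are admissible
exits; round 1's statement is the special case `Y := 2^{(log₂ n + c)^c}` with the transfer discharged by
`L(·) ≤ L(per_n · h)`).  Every nonzero single-typed multiplier `h` that is THIN-POOR at level `c` admits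
EITHER (i) a face `G` and a level `Y` such that hardness of the face permanent `per(G)` above `Y` transfers
to hardness of `per_n · h` above `2^{(log₂ n + c)^c}`, and the face is rich enough for S4 to certify `per(G)`
above `Y` (`2(n²+1)·n!·Y < |PM(G)|·n(2^{n-1}-1)`), OR (ii) a pair `per(G)·h'`, a level `Y` with the same
transfer property, and a path certificate (S1) for `per(G)·h'` of value `> 2Y`.
Status (lead-1 analysis, crux `NOTES.md` §S5): S5 is CRUX-COMPLETE — with `G = K_{n,n}` resp. `(G,h') = (K,1)`
both branches contain `L(per_n) ≤ L(per_n·h)`; it cannot be refuted below a GCT-grade event and can only be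
promoted.  Reach of the intended proof system: (i) covers non-aligned `h` (isolate a monomial by faces, push
`per` off its support, project; or strip it by JSS), unions of few supports (`per·h ≥ per_{K∖U}·h(1)`), and
`deg h ≤ n/3` (disprover's rung); (ii) needs a cofactor with ≥ 2^X monomials spread over fibres and a RIGID
test layer (forest supports; fat layers are void by sub-table multiplicity), with a potential immune to
near-proportional and unit-matching boxes (the disjunctive `rowsupp > 2n/3 ∨ mass > tot/2` survives on the
declared falsifier `T_{r,r}` in experiment E1d).  [conjecture] -/
theorem stub_hybridDescent :
    ∀ c : ℕ, ∃ n₀ : ℕ, ∀ n ≥ n₀, ∀ (h : MvPolynomial (Fin n × Fin n) NNReal) (τ : (Fin n →₀ ℕ) × (Fin n →₀ ℕ)),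
      h ≠ 0 →
      (∀ m ∈ h.support, (Finsupp.mapDomain Prod.fst m, Finsupp.mapDomain Prod.snd m) = τ) →
      ((((Finset.univ : Finset (Equiv.Perm (Fin n))).filter (fun π =>
            ∃ m ∈ h.support, ∀ e : Fin n × Fin n, m e ≠ 0 → π e.2 = e.1)).card : ℕ) : ℝ) *
            (n.choose (n / 3) : ℝ) ≤
          2 * (n.factorial : ℝ) * (2 : ℝ) ^ ((Nat.log 2 n + c) ^ c) →
      (∃ (G : Finset (Fin n × Fin n)) (Y : ℝ),
          (Y < (Literature.Computability.AlgebraicComplexity.complexity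
              (∑ π ∈ (Finset.univ : Finset (Equiv.Perm (Fin n))).filter (fun π => ∀ i : Fin n, (π i, i) ∈ G),
                ∏ i : Fin n, (MvPolynomial.X (π i, i) : MvPolynomial (Fin n × Fin n) NNReal)) : ℝ) →
            (2 : ℝ) ^ ((Nat.log 2 n + c) ^ c) <
              (Literature.Computability.AlgebraicComplexity.complexity
                (Literature.Computability.AlgebraicComplexity.perPoly (Fin n) NNReal * h) : ℝ)) ∧
          2 * (((n : ℝ) ^ 2 + 1) * (n.factorial : ℝ)) * Y <
            ((((Finset.univ : Finset (Equiv.Perm (Fin n))).filter (fun π => ∀ i : Fin n, (π i, i) ∈ G)).card : ℕ) : ℝ) *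
              ((n : ℝ) * ((2 : ℝ) ^ (n - 1) - 1))) ∨
      (∃ (G : Finset (Fin n × Fin n)) (h' : MvPolynomial (Fin n × Fin n) NNReal) (Y : ℝ),
          (Y < (Literature.Computability.AlgebraicComplexity.complexity
              ((∑ π ∈ (Finset.univ : Finset (Equiv.Perm (Fin n))).filter (fun π => ∀ i : Fin n, (π i, i) ∈ G),
                ∏ i : Fin n, (MvPolynomial.X (π i, i) : MvPolynomial (Fin n × Fin n) NNReal)) * h') : ℝ) →
            (2 : ℝ) ^ ((Nat.log 2 n + c) ^ c) <
              (Literature.Computability.AlgebraicComplexity.complexity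
                (Literature.Computability.AlgebraicComplexity.perPoly (Fin n) NNReal * h) : ℝ)) ∧
          ∃ (τg : (Fin n →₀ ℕ) × (Fin n →₀ ℕ)) (p : ((Fin n × Fin n) →₀ ℕ) → ℝ)
            (φ : (Fin n →₀ ℕ) × (Fin n →₀ ℕ) → ℝ),
            (∀ m ∈ ((∑ π ∈ (Finset.univ : Finset (Equiv.Perm (Fin n))).filter (fun π => ∀ i : Fin n, (π i, i) ∈ G),
                ∏ i : Fin n, (MvPolynomial.X (π i, i) : MvPolynomial (Fin n × Fin n) NNReal)) * h').support,
              (Finsupp.mapDomain Prod.fst m, Finsupp.mapDomain Prod.snd m) = τg) ∧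
            (∀ m, 0 ≤ p m) ∧ φ 0 ≤ 0 ∧
            (∀ e : Fin n × Fin n, φ (Finsupp.single e.1 1, Finsupp.single e.2 1) ≤ 0) ∧
            (∀ (A B C : Finset ((Fin n × Fin n) →₀ ℕ)) (τ₁ τ₂ : (Fin n →₀ ℕ) × (Fin n →₀ ℕ)),
              (∀ a ∈ A, (Finsupp.mapDomain Prod.fst a, Finsupp.mapDomain Prod.snd a) = τ₁) →
              (∀ b ∈ B, (Finsupp.mapDomain Prod.fst b, Finsupp.mapDomain Prod.snd b) = τ₂) →
              (∀ a ∈ A, ∀ b ∈ B, ∀ c ∈ C, a + b + c ∈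
                ((∑ π ∈ (Finset.univ : Finset (Equiv.Perm (Fin n))).filter (fun π => ∀ i : Fin n, (π i, i) ∈ G),
                  ∏ i : Fin n, (MvPolynomial.X (π i, i) : MvPolynomial (Fin n × Fin n) NNReal)) * h').support) →
              (φ (τ₁ + τ₂) - max (φ τ₁) (φ τ₂)) * (∑ a ∈ A, ∑ b ∈ B, ∑ c ∈ C, p (a + b + c)) ≤ 1) ∧
            2 * Y <
              (∑ m ∈ ((∑ π ∈ (Finset.univ : Finset (Equiv.Perm (Fin n))).filter (fun π => ∀ i : Fin n, (π i, i) ∈ G),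
                  ∏ i : Fin n, (MvPolynomial.X (π i, i) : MvPolynomial (Fin n × Fin n) NNReal)) * h').support, p m) *
                φ τg) := by
  sorry

/-! ## Composition (sorry-free): the five stubs prove the crux BY NAME -/

/-- From a path certificate of value `> 2Y` for a single-typed `g`, the engine S1 gives `Y < L(g)`. -/
theorem lt_complexity_of_certificate {n : ℕ} (g : MvPolynomial (Fin n × Fin n) NNReal) (Y : ℝ)
    (hcert : ∃ (τg : (Fin n →₀ ℕ) × (Fin n →₀ ℕ)) (p : ((Fin n × Fin n) →₀ ℕ) → ℝ)
        (φ : (Fin n →₀ ℕ) × (Fin n →₀ ℕ) → ℝ),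
        (∀ m ∈ g.support, (Finsupp.mapDomain Prod.fst m, Finsupp.mapDomain Prod.snd m) = τg) ∧
        (∀ m, 0 ≤ p m) ∧ φ 0 ≤ 0 ∧
        (∀ e : Fin n × Fin n, φ (Finsupp.single e.1 1, Finsupp.single e.2 1) ≤ 0) ∧
        (∀ (A B C : Finset ((Fin n × Fin n) →₀ ℕ)) (τ₁ τ₂ : (Fin n →₀ ℕ) × (Fin n →₀ ℕ)),
          (∀ a ∈ A, (Finsupp.mapDomain Prod.fst a, Finsupp.mapDomain Prod.snd a) = τ₁) →
          (∀ b ∈ B, (Finsupp.mapDomain Prod.fst b, Finsupp.mapDomain Prod.snd b) = τ₂) →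
          (∀ a ∈ A, ∀ b ∈ B, ∀ c ∈ C, a + b + c ∈ g.support) →
          (φ (τ₁ + τ₂) - max (φ τ₁) (φ τ₂)) * (∑ a ∈ A, ∑ b ∈ B, ∑ c ∈ C, p (a + b + c)) ≤ 1) ∧
        2 * Y < (∑ m ∈ g.support, p m) * φ τg) :
    Y < (Literature.Computability.AlgebraicComplexity.complexity g : ℝ) := by
  obtain ⟨τg, p, φ, hτ, hp, h0, h1, hfeas, hval⟩ := hcert
  have hS1 := stub_pathWeightBound n g τg hτ p hp φ h0 h1 hfeas
  linarith

/-- **The line decides the crux**: `stub_pathWeightBound`, `stub_multihomogeneousNormalForm`,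
`stub_thinCertificate`, `stub_faceCertificate`, `stub_hybridDescent` ⊢ `PerMultiplesHard`
(route `DivisionGap`, item stmt-ValiantsHypothesis-5068), concluded by name. -/
theorem PerMultiplesHard_of :
    Summit.ValiantsHypothesis.ValiantsHypothesis.Theses.DivisionGap.PerMultiplesHard := by
  intro c
  obtain ⟨n₅, hn₅⟩ := stub_hybridDescent c
  refine ⟨max 3 n₅, ?_⟩
  intro n hn h hh
  have hn3 : 3 ≤ n := le_trans (le_max_left 3 n₅) hn
  have hn5 : n ≥ n₅ := le_trans (le_max_right 3 n₅) hn
  -- normal form: a nonzero single-typed slice `h'` with `L(per·h') ≤ L(per·h)`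
  obtain ⟨h', hh', -, ⟨τ, hτ⟩, hle, -⟩ := stub_multihomogeneousNormalForm n h hh
  refine lt_of_lt_of_le ?_ hle
  -- abbreviations
  set X : ℝ := (2 : ℝ) ^ ((Nat.log 2 n + c) ^ c) with hX
  set per : MvPolynomial (Fin n × Fin n) NNReal :=
    Literature.Computability.AlgebraicComplexity.perPoly (Fin n) NNReal with hper
  -- it suffices to prove the real-number inequality `X < L(per·h')`
  suffices hreal : X < (Literature.Computability.AlgebraicComplexity.complexity (per * h') : ℝ) by
    rw [hX] at hreal
    exact_mod_cast hreal
  have hfac : (0 : ℝ) < (n.factorial : ℝ) := by exact_mod_cast Nat.factorial_pos n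
  by_cases hthin :
      2 * (n.factorial : ℝ) * X <
        ((((Finset.univ : Finset (Equiv.Perm (Fin n))).filter (fun π =>
            ∃ m ∈ h'.support, ∀ e : Fin n × Fin n, m e ≠ 0 → π e.2 = e.1)).card : ℕ) : ℝ) *
          (n.choose (n / 3) : ℝ)
  · -- thin-rich: the thin certificate S3
    obtain ⟨τg, p, φ, hτg, hp, h0, h1, hfeas, hval⟩ := stub_thinCertificate n hn3 h' τ hτ
    refine lt_complexity_of_certificate (per * h') X ⟨τg, p, φ, hτg, hp, h0, h1, hfeas, ?_⟩
    have h2 : 2 * (n.factorial : ℝ) * X <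
        (n.factorial : ℝ) * ((∑ m ∈ (per * h').support, p m) * φ τg) := lt_of_lt_of_le hthin hval
    nlinarith
  · -- thin-poor: the hybrid descent S5
    have hpoor :
        ((((Finset.univ : Finset (Equiv.Perm (Fin n))).filter (fun π =>
            ∃ m ∈ h'.support, ∀ e : Fin n × Fin n, m e ≠ 0 → π e.2 = e.1)).card : ℕ) : ℝ) *
            (n.choose (n / 3) : ℝ) ≤
          2 * (n.factorial : ℝ) * X := not_lt.mp hthin
    rcases hn₅ n hn5 h' τ hh' hτ hpoor with ⟨G, Y, himp, hrich⟩ | ⟨G, h'', Y, himp, hcert⟩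
    · -- (i) a rich face with hardness transfer at level `Y`: the face certificate S4 gives `Y < L(per_G)`
      refine himp ?_
      obtain ⟨τg, p, φ, hτg, hp, h0, h1, hfeas, hval⟩ := stub_faceCertificate n G
      refine lt_complexity_of_certificate _ Y ⟨τg, p, φ, hτg, hp, h0, h1, hfeas, ?_⟩
      have hpos : (0 : ℝ) < ((n : ℝ) ^ 2 + 1) * (n.factorial : ℝ) := by positivity
      have h3 : 2 * (((n : ℝ) ^ 2 + 1) * (n.factorial : ℝ)) * Y <
          (((n : ℝ) ^ 2 + 1) * (n.factorial : ℝ)) *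
            ((∑ m ∈ (∑ π ∈ (Finset.univ : Finset (Equiv.Perm (Fin n))).filter
                  (fun π => ∀ i : Fin n, (π i, i) ∈ G),
                ∏ i : Fin n, (MvPolynomial.X (π i, i) : MvPolynomial (Fin n × Fin n) NNReal)).support, p m) *
              φ τg) := lt_of_lt_of_le hrich hval
      nlinarith
    · -- (ii) a certified pair with hardness transfer at level `Y`
      exact himp (lt_complexity_of_certificate _ Y hcert)

end Summit.ValiantsHypothesis.ValiantsHypothesis.Cruxes.PerMultiplesHard.TypedParseTreeWeights

end
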